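import Summits.Ventures.WeilGRH.FrontierDoubleRungs
import HarnessLib

/-!
# GRH arm (rh-explicit, venture WeilGRH): phase cells for a UNIFORM frontier transfer

`FrontierDoubleRungs.lean` instantiates the frontier double transfer (`2·4` on the pair/triple fibres of the
shift `log 2`, `3` reflected, convex combination) for sub-families with a FIXED value of `χ(2)` (`0` or `−1`).
For a statement uniform over ALL characters of a modulus `q` the value `z = χ(2)` ranges over the unit circle
(`2 ∤ q`); the master theorem `weilPositivityOnChar_frontier_of_double` already absorbs, through its slack `ε`,
the distance between the true data `(k₂'(1 − z), k₄'(1 − z²))` and any rational reference data. This file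
provides the bookkeeping that turns a CELL of the circle — `z` with `‖z‖ = 1`, `α ≤ Re z ≤ β` and a sign of
`Im z` — into that slack:

* `DirichletCharacter.norm_apply_eq_one_of_ne_zero` — `χ(n) ≠ 0 ⇒ ‖χ(n)‖ = 1`;
* `im_mem_of_cell_nonneg` / `im_mem_of_cell_nonpos` — on the circle an `x`-range pins `Im z` in a rational box;
* `norm_sub_le_of_box` — `‖z − m‖ ≤ δ` from the four box corners;
* `frontier_slack_of_near` — `2‖k₂'(1 − z) − κ₂ω₂‖ + ‖k₄'(1 − z²) − c₄‖ ≤ ε` when `κ₂ω₂ = 0.49013(1 − m)`,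
  `c₄ = 0.3465736(1 − m²)` and `‖z − m‖ ≤ δ`;
* `weilPositivityOnChar_frontier_of_cell` — the frontier `4023/5000` for every `χ` mod `q` whose `χ(2)` lies in
  a cell carrying a verified certificate (all numerical hypotheses rational, decided by `norm_num` downstream).

The cells themselves (rh-explicit-weil-grh-2 gen5, `work/frontier/design_cells.py`, exact rational arithmetic)
are in `FrontierPhaseCells*.lean`; the uniform theorems in `FrontierUniform.lean`.

## References

* A. Weil (1952), (11) and the «lemme» p. 262; H. Yoshida (1992) §6.
-/

noncomputable section

open Complex Filter Set MeasureTheory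
open scoped Real Topology ComplexConjugate

namespace Summit.Ventures.WeilGRH

open Literature.NumberTheory.LFunctions

variable {q : ℕ}

/-! ## Values of a Dirichlet character: `0` or on the unit circle -/

/-- A non-zero value of a Dirichlet character has norm one. [folklore] -/
theorem DirichletCharacter.norm_apply_eq_one_of_ne_zero (χ : DirichletCharacter ℂ q) {n : ZMod q}
    (h : χ n ≠ 0) : ‖χ n‖ = 1 := by
  by_cases hu : IsUnit n
  · exact χ.unit_norm_eq_one hu.unit
  · exact absurd (χ.map_nonunit hu) h

/-! ## Geometry of a cell -/

/-- For `x ∈ [α, β]`: `(x − c)² ≤ max((α − c)², (β − c)²)`, in the form of two alternatives. [folklore] -/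
theorem sq_sub_le_of_mem {x α β c : ℝ} (hα : α ≤ x) (hβ : x ≤ β) :
    (x - c) ^ 2 ≤ (α - c) ^ 2 ∨ (x - c) ^ 2 ≤ (β - c) ^ 2 := by
  rcases le_or_gt (x + α - 2 * c) 0 with h | h
  · left; nlinarith
  · right; nlinarith

/-- On the unit circle, an `x`-range `[α, β]` not straddling `0` and `Im z ≥ 0` pin `Im z` in `[ylo, yhi]`. [folklore] -/
theorem im_mem_of_cell_nonneg {z : ℂ} (hz : ‖z‖ = 1) {α β ylo yhi : ℝ} (hα : α ≤ z.re) (hβ : z.re ≤ β)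
    (hy : 0 ≤ z.im) (hylo : 0 ≤ ylo) (hyloα : ylo ^ 2 + α ^ 2 ≤ 1) (hyloβ : ylo ^ 2 + β ^ 2 ≤ 1)
    (hyhi0 : 0 ≤ yhi) (hyhi : (1 ≤ yhi ^ 2 + α ^ 2 ∧ 0 ≤ α) ∨ (1 ≤ yhi ^ 2 + β ^ 2 ∧ β ≤ 0)) :
    ylo ≤ z.im ∧ z.im ≤ yhi := by
  have hn : z.re ^ 2 + z.im ^ 2 = 1 := by
    have h := Complex.sq_norm z
    rw [hz, Complex.normSq_apply] at h
    nlinarith [h]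
  constructor
  · have hx2 : z.re ^ 2 ≤ 1 - ylo ^ 2 := by
      rcases sq_sub_le_of_mem (c := 0) hα hβ with h | h
      · simp only [sub_zero] at h; linarith
      · simp only [sub_zero] at h; linarith
    have h2 : ylo ^ 2 ≤ z.im ^ 2 := by linarith
    exact (pow_le_pow_iff_left₀ hylo hy two_ne_zero).1 h2
  · have h2 : z.im ^ 2 ≤ yhi ^ 2 := by
      rcases hyhi with ⟨h1, h0⟩ | ⟨h1, h0⟩
      · have : α ^ 2 ≤ z.re ^ 2 := by nlinarith
        linarith
      · have : β ^ 2 ≤ z.re ^ 2 := by nlinarith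
        linarith
    exact (pow_le_pow_iff_left₀ hy hyhi0 two_ne_zero).1 h2

/-- The mirror statement for `Im z ≤ 0`: `Im z ∈ [−yhi, −ylo]`. [folklore] -/
theorem im_mem_of_cell_nonpos {z : ℂ} (hz : ‖z‖ = 1) {α β ylo yhi : ℝ} (hα : α ≤ z.re) (hβ : z.re ≤ β)
    (hy : z.im ≤ 0) (hylo : 0 ≤ ylo) (hyloα : ylo ^ 2 + α ^ 2 ≤ 1) (hyloβ : ylo ^ 2 + β ^ 2 ≤ 1)
    (hyhi0 : 0 ≤ yhi) (hyhi : (1 ≤ yhi ^ 2 + α ^ 2 ∧ 0 ≤ α) ∨ (1 ≤ yhi ^ 2 + β ^ 2 ∧ β ≤ 0)) :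
    -yhi ≤ z.im ∧ z.im ≤ -ylo := by
  have hz' : ‖conj z‖ = 1 := by rw [Complex.norm_conj, hz]
  have h := im_mem_of_cell_nonneg hz' (α := α) (β := β) (by simpa using hα) (by simpa using hβ)
    (by simp; linarith) hylo hyloα hyloβ hyhi0 hyhi
  simp only [Complex.conj_im] at h
  constructor <;> linarith [h.1, h.2]

/-- `‖z − m‖ ≤ δ` for `z` in the box `[α, β] × [yl, yh]` from the four corners. [folklore] -/
theorem norm_sub_le_of_box {z m : ℂ} {α β yl yh δ : ℝ} (hα : α ≤ z.re) (hβ : z.re ≤ β)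
    (hyl : yl ≤ z.im) (hyh : z.im ≤ yh) (hδ : 0 ≤ δ)
    (c1 : (α - m.re) ^ 2 + (yl - m.im) ^ 2 ≤ δ ^ 2) (c2 : (α - m.re) ^ 2 + (yh - m.im) ^ 2 ≤ δ ^ 2)
    (c3 : (β - m.re) ^ 2 + (yl - m.im) ^ 2 ≤ δ ^ 2) (c4 : (β - m.re) ^ 2 + (yh - m.im) ^ 2 ≤ δ ^ 2) :
    ‖z - m‖ ≤ δ := by
  have hsq : ‖z - m‖ ^ 2 = (z.re - m.re) ^ 2 + (z.im - m.im) ^ 2 := by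
    rw [Complex.sq_norm, Complex.normSq_apply, Complex.sub_re, Complex.sub_im]; ring
  have h2 : ‖z - m‖ ^ 2 ≤ δ ^ 2 := by
    rw [hsq]
    rcases sq_sub_le_of_mem (c := m.re) hα hβ with hx | hx <;>
      rcases sq_sub_le_of_mem (c := m.im) hyl hyh with hy | hy <;> linarith
  exact (pow_le_pow_iff_left₀ (norm_nonneg _) hδ two_ne_zero).1 h2

/-- `‖w‖ = 1` from `Re w² + Im w² = 1` (Pythagorean phases). [folklore] -/
theorem norm_eq_one_of_sq {w : ℂ} (h : w.re ^ 2 + w.im ^ 2 = 1) : ‖w‖ = 1 := by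
  have h2 : ‖w‖ ^ 2 = 1 := by rw [Complex.sq_norm, Complex.normSq_apply]; nlinarith [h]
  have h0 : 0 ≤ ‖w‖ := norm_nonneg _
  nlinarith [h2, h0]

/-! ## The slack of a cell -/

/-- **Slack of a cell.** If `‖z‖ = 1`, `‖z − m‖ ≤ δ`, the reference data are `κ₂ω₂ = 0.49013(1 − m)` and
`c₄ = 0.3465736(1 − m²)`, and `‖m‖ ≤ M`, `‖1 − m‖ ≤ n₁`, `‖1 − m²‖ ≤ n₂`, then
`2‖k₂'(1 − z) − κ₂ω₂‖ + ‖k₄'(1 − z²) − c₄‖ ≤ 2(0.49014 δ + 10⁻⁵ n₁) + (0.3465736 δ (1 + M) + 10⁻⁷ n₂)`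
(`k₂' = log 2/√2 ∈ [0.49012, 0.49014]`, `k₄' = log 2/2 ∈ [0.34657359, 0.3465736]`). [folklore] -/
theorem frontier_slack_of_near {z m c₂ c₄ : ℂ} {δ M n₁ n₂ ε : ℝ} (hz : ‖z‖ = 1) (hzm : ‖z - m‖ ≤ δ)
    (hc₂ : c₂ = ((0.49013 : ℝ) : ℂ) * (1 - m)) (hc₄ : c₄ = ((0.3465736 : ℝ) : ℂ) * (1 - m * m))
    (hM : ‖m‖ ≤ M) (hn₁ : ‖1 - m‖ ≤ n₁) (hn₂ : ‖1 - m * m‖ ≤ n₂)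
    (hε : 2 * (0.49014 * δ + 0.00001 * n₁) + (0.3465736 * δ * (1 + M) + 0.0000001 * n₂) ≤ ε) :
    2 * ‖((Real.log 2 / Real.sqrt 2 : ℝ) : ℂ) * (1 - z) - c₂‖ +
      ‖((Real.log 2 / 2 : ℝ) : ℂ) * (1 - z * z) - c₄‖ ≤ ε := by
  obtain ⟨hk1, hk2⟩ := kprime_bounds
  obtain ⟨hf1, hf2⟩ := kfour_bounds
  set k₂ : ℝ := Real.log 2 / Real.sqrt 2 with hk₂
  set k₄ : ℝ := Real.log 2 / 2 with hk₄
  have hδ0 : 0 ≤ δ := (norm_nonneg _).trans hzm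
  have hM0 : 0 ≤ M := (norm_nonneg _).trans hM
  -- n = 2
  have e2 : (k₂ : ℂ) * (1 - z) - c₂ = (k₂ : ℂ) * (m - z) + ((k₂ - 0.49013 : ℝ) : ℂ) * (1 - m) := by
    rw [hc₂]; push_cast; ring
  have b2 : ‖(k₂ : ℂ) * (1 - z) - c₂‖ ≤ 0.49014 * δ + 0.00001 * n₁ := by
    rw [e2]
    refine (norm_add_le _ _).trans ?_
    rw [norm_mul (k₂ : ℂ) (m - z), norm_mul ((k₂ - 0.49013 : ℝ) : ℂ) (1 - m), Complex.norm_real,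
      Complex.norm_real, Real.norm_eq_abs, Real.norm_eq_abs, norm_sub_rev]
    have a1 : |k₂| ≤ 0.49014 := abs_le.2 ⟨by linarith, hk2⟩
    have a2 : |k₂ - 0.49013| ≤ 0.00001 := abs_le.2 ⟨by linarith, by linarith⟩
    have := mul_le_mul a1 hzm (norm_nonneg _) (by norm_num)
    have := mul_le_mul a2 hn₁ (norm_nonneg _) (by norm_num)
    linarith
  -- n = 4
  have e4 : (k₄ : ℂ) * (1 - z * z) - c₄ = (k₄ : ℂ) * ((m - z) * (z + m)) +
      ((k₄ - 0.3465736 : ℝ) : ℂ) * (1 - m * m) := by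
    rw [hc₄]; push_cast; ring
  have hzm2 : ‖(m - z) * (z + m)‖ ≤ δ * (1 + M) := by
    rw [norm_mul, norm_sub_rev]
    refine mul_le_mul hzm ((norm_add_le _ _).trans ?_) (norm_nonneg _) hδ0
    rw [hz]; linarith
  have b4 : ‖(k₄ : ℂ) * (1 - z * z) - c₄‖ ≤ 0.3465736 * δ * (1 + M) + 0.0000001 * n₂ := by
    rw [e4]
    refine (norm_add_le _ _).trans ?_
    rw [norm_mul (k₄ : ℂ) ((m - z) * (z + m)), norm_mul ((k₄ - 0.3465736 : ℝ) : ℂ) (1 - m * m),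
      Complex.norm_real, Complex.norm_real, Real.norm_eq_abs, Real.norm_eq_abs]
    have a1 : |k₄| ≤ 0.3465736 := abs_le.2 ⟨by linarith, hf2⟩
    have a2 : |k₄ - 0.3465736| ≤ 0.0000001 := abs_le.2 ⟨by linarith, by linarith⟩
    have := mul_le_mul a1 hzm2 (norm_nonneg _) (by norm_num)
    have := mul_le_mul a2 hn₂ (norm_nonneg _) (by norm_num)
    linarith
  linarith

/-! ## Lower bounds for `log q` -/

/-- `3.401196 ≤ log 30`. [folklore] -/
theorem log_thirty_ge : (3.401196 : ℝ) ≤ Real.log 30 := by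
  rw [show (30 : ℝ) = 2 * 3 * 5 by norm_num, Real.log_mul (by norm_num) (by norm_num),
    Real.log_mul (by norm_num) (by norm_num)]
  linarith [Real.log_two_gt_d9, Real.log_three_gt_d9, Real.log_five_gt_d9]

/-- `3.688878 ≤ log 40`. [folklore] -/
theorem log_forty_ge : (3.688878 : ℝ) ≤ Real.log 40 := by
  rw [show (40 : ℝ) = 2 ^ 3 * 5 by norm_num, Real.log_mul (by norm_num) (by norm_num), Real.log_pow]
  push_cast; linarith [Real.log_two_gt_d9, Real.log_five_gt_d9]

/-! ## The frontier for a cell of phases -/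

/-- **The `ζ` frontier `4023/5000` for every `χ` whose `χ(2)` lies in a certified CELL of the unit circle.**
The cell is `‖χ(2)‖ = 1`, `α ≤ Re χ(2) ≤ β`, `yl ≤ Im χ(2) ≤ yh`; the certificate is the frontier double transfer
at the rational reference data `κ₂ω₂ = 0.49013(1 − m)`, `c₄ = 0.3465736(1 − m²)` (`m` a rational point near the
cell, `‖χ(2) − m‖ ≤ δ` by the box corners), with the distance to the true data charged as the slack `ε`
(`frontier_slack_of_near`), an `LDL*` datum `(p, r, s, d₂, d₃)`, the `2·4` criterion on the interval bounds of
`FrontierDoubleConstants.lean`, and the `3`-criterion at the endpoints `‖1 − χ(3)‖² ∈ {0, 4}` (affine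
interpolation, any `χ(3)`). [cite: Weil1952FormulesExplicites, the «lemme» p. 262; Yoshida1992 §6] -/
theorem weilPositivityOnChar_frontier_of_cell [NeZero q] (hq1 : q ≠ 1) (χ : DirichletCharacter ℂ q)
    {B : ℝ} (hBq : B ≤ Real.log q) (hz : ‖χ (2 : ZMod q)‖ = 1) {α β yl yh : ℝ}
    (hα : α ≤ (χ (2 : ZMod q)).re) (hβ : (χ (2 : ZMod q)).re ≤ β)
    (hyl : yl ≤ (χ (2 : ZMod q)).im) (hyh : (χ (2 : ZMod q)).im ≤ yh)
    {κ₂ : ℝ} {ω₂ m c₄ : ℂ} (hω₂ : ‖ω₂‖ = 1) (hκ₂ : 0 ≤ κ₂)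
    (hm : (κ₂ : ℂ) * ω₂ = ((0.49013 : ℝ) : ℂ) * (1 - m)) (hc₄ : c₄ = ((0.3465736 : ℝ) : ℂ) * (1 - m * m))
    {δ M n₁ n₂ ε : ℝ} (hδ : 0 ≤ δ)
    (c1 : (α - m.re) ^ 2 + (yl - m.im) ^ 2 ≤ δ ^ 2) (c2 : (α - m.re) ^ 2 + (yh - m.im) ^ 2 ≤ δ ^ 2)
    (c3 : (β - m.re) ^ 2 + (yl - m.im) ^ 2 ≤ δ ^ 2) (c4 : (β - m.re) ^ 2 + (yh - m.im) ^ 2 ≤ δ ^ 2)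
    (hM : ‖m‖ ≤ M) (hn₁ : ‖1 - m‖ ≤ n₁) (hn₂ : ‖1 - m * m‖ ≤ n₂)
    (hε : 2 * (0.49014 * δ + 0.00001 * n₁) + (0.3465736 * δ * (1 + M) + 0.0000001 * n₂) ≤ ε)
    {B₂₄ B₃ t₂₄ t₃ : ℝ} (hκB₂ : κ₂ < B₂₄) (hBB : B₂₄ + B₃ + ε ≤ B) (ht₂₄ : 0 ≤ t₂₄) (ht₃ : 0 ≤ t₃)
    (ht : 2 ≤ t₂₄ + t₃) (hB₃ : 0 < B₃) {d₂ d₃ : ℝ} (hd₂ : 0 < d₂) (hd₃ : 0 < d₃) {p r s : ℂ}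
    (hI : B₂₄ * ‖p‖ ^ 2 + d₂ = B₂₄) (hII : B₂₄ * ‖r‖ ^ 2 + d₂ * ‖s‖ ^ 2 + d₃ = B₂₄)
    (hIII : (B₂₄ : ℂ) * conj p = κ₂ * ω₂) (hIV : (B₂₄ : ℂ) * conj r = c₄)
    (hV : (B₂₄ : ℂ) * p * conj r + d₂ * conj s = κ₂ * ω₂)
    (hG : ∀ CP IP J11 J22 J33 J12 J13 J23 : ℝ, 0.486803 ≤ CP → CP ≤ 0.486813 → 0.48667 ≤ IP → IP ≤ 0.48668 →
      0.251052 ≤ J11 → J11 ≤ 0.251063 → 0.223131 ≤ J22 → J22 ≤ 0.223142 → 0.251052 ≤ J33 → J33 ≤ 0.251063 →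
      0.236666 ≤ J12 → J12 ≤ 0.236678 → 0.250994 ≤ J13 → J13 ≤ 0.251005 → 0.236666 ≤ J23 → J23 ≤ 0.236678 →
      t₂₄ * ((CP + ω₂.re * IP) / (B₂₄ + κ₂) + (CP - ω₂.re * IP) / (B₂₄ - κ₂) +
        (J11 / B₂₄ + (J22 - 2 * p.re * J12 + ‖p‖ ^ 2 * J11) / d₂ +
          (J33 + ‖s‖ ^ 2 * J22 + ‖p * s - r‖ ^ 2 * J11 - 2 * s.re * J23 + 2 * (p * s - r).re * J13 -
            2 * (s * conj (p * s - r)).re * J12) / d₃)) ≤ 1)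
    (hB₃4 : 0.6343 ^ 2 * 4 < B₃ ^ 2)
    (h₃0 : t₃ * (0.59228 * (B₃ ^ 2 - 0.63428 ^ 2 * 0) +
        2 * B₃ * (B₃ * 0.5533 - 0.63428 * ((0 : ℝ) / 2) * 0.55286)) ≤ B₃ * (B₃ ^ 2 - 0.6343 ^ 2 * 0))
    (h₃4 : t₃ * (0.59228 * (B₃ ^ 2 - 0.63428 ^ 2 * 4) +
        2 * B₃ * (B₃ * 0.5533 - 0.63428 * ((4 : ℝ) / 2) * 0.55286)) ≤ B₃ * (B₃ ^ 2 - 0.6343 ^ 2 * 4)) :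
    WeilPositivityOnChar χ (4023 / 5000) := by
  have h4 : χ (4 : ZMod q) = χ (2 : ZMod q) * χ (2 : ZMod q) := char_four_eq_sq χ
  have hzm : ‖χ (2 : ZMod q) - m‖ ≤ δ := norm_sub_le_of_box hα hβ hyl hyh hδ c1 c2 c3 c4
  have hεz := frontier_slack_of_near (c₂ := (κ₂ : ℂ) * ω₂) hz hzm hm hc₄ hM hn₁ hn₂ hε
  have hε' : 2 * ‖((Real.log 2 / Real.sqrt 2 : ℝ) : ℂ) * (1 - χ (2 : ZMod q)) - κ₂ * ω₂‖ +
      ‖((Real.log 2 / 2 : ℝ) : ℂ) * (1 - χ (4 : ZMod q)) - (1 : ℝ) * c₄‖ ≤ ε := by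
    rw [h4]; simpa using hεz
  have hIV' : (B₂₄ : ℂ) * conj r = (1 : ℝ) * c₄ := by simpa using hIV
  have hσ := normSq_one_sub_char_three_le_four χ
  have hσ₃ : 0.6343 ^ 2 * ‖1 - χ (3 : ZMod q)‖ ^ 2 < B₃ ^ 2 := by
    nlinarith [sq_nonneg ‖1 - χ (3 : ZMod q)‖]
  have h₃ := bounded_criterion_interpolate (by norm_num) (by norm_num) hB₃.le ht₃ h₃0 h₃4 (sq_nonneg _) hσ
    (normSq_one_sub_half_le_re (χ.norm_le_one _))
  exact weilPositivityOnChar_frontier_of_double hq1 χ hω₂ hκ₂ hκB₂ hε' hBq hBB ht₂₄ ht₃ ht hB₃ hd₂ hd₃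
    hI hII hIII hIV' hV hG hσ₃ h₃

/-- **Cell certificate in REAL coordinates** (the form the generated cells use: every hypothesis is a closed
rational statement decided by `norm_num`). Phases `ω₂ = u + iv` (`u² + v² = 1`, Pythagorean), reference point
`m = mx + i·my`, `LDL*` datum `p = pr + i·pi`, `r = rr + i·ri`, `s = sr + i·si`, `e = ps − r = er + i·ei`.
[cite: Weil1952FormulesExplicites, the «lemme» p. 262; Yoshida1992 §6] -/
theorem weilPositivityOnChar_frontier_of_cell_re [NeZero q] (hq1 : q ≠ 1) (χ : DirichletCharacter ℂ q)
    {B : ℝ} (hBq : B ≤ Real.log q) (hz : ‖χ (2 : ZMod q)‖ = 1) {α β yl yh : ℝ}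
    (hα : α ≤ (χ (2 : ZMod q)).re) (hβ : (χ (2 : ZMod q)).re ≤ β)
    (hyl : yl ≤ (χ (2 : ZMod q)).im) (hyh : (χ (2 : ZMod q)).im ≤ yh)
    {u v κ₂ mx my δ M n₁ n₂ ε B₂₄ B₃ t₂₄ t₃ d₂ d₃ pr pi rr ri sr si er ei : ℝ}
    (hω : u ^ 2 + v ^ 2 = 1) (hκ₂ : 0 ≤ κ₂)
    (hm1 : κ₂ * u = 0.49013 * (1 - mx)) (hm2 : κ₂ * v = -(0.49013 * my))
    (hδ : 0 ≤ δ)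
    (c1 : (α - mx) ^ 2 + (yl - my) ^ 2 ≤ δ ^ 2) (c2 : (α - mx) ^ 2 + (yh - my) ^ 2 ≤ δ ^ 2)
    (c3 : (β - mx) ^ 2 + (yl - my) ^ 2 ≤ δ ^ 2) (c4 : (β - mx) ^ 2 + (yh - my) ^ 2 ≤ δ ^ 2)
    (hM0 : 0 ≤ M) (hM : mx ^ 2 + my ^ 2 ≤ M ^ 2) (hn₁0 : 0 ≤ n₁) (hn₁ : (1 - mx) ^ 2 + my ^ 2 ≤ n₁ ^ 2)
    (hn₂0 : 0 ≤ n₂) (hn₂ : (1 - (mx ^ 2 - my ^ 2)) ^ 2 + (2 * mx * my) ^ 2 ≤ n₂ ^ 2)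
    (hε : 2 * (0.49014 * δ + 0.00001 * n₁) + (0.3465736 * δ * (1 + M) + 0.0000001 * n₂) ≤ ε)
    (hκB₂ : κ₂ < B₂₄) (hBB : B₂₄ + B₃ + ε ≤ B) (ht₂₄ : 0 ≤ t₂₄) (ht₃ : 0 ≤ t₃)
    (ht : 2 ≤ t₂₄ + t₃) (hB₃ : 0 < B₃) (hd₂ : 0 < d₂) (hd₃ : 0 < d₃)
    (hI : B₂₄ * (pr ^ 2 + pi ^ 2) + d₂ = B₂₄)
    (hII : B₂₄ * (rr ^ 2 + ri ^ 2) + d₂ * (sr ^ 2 + si ^ 2) + d₃ = B₂₄)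
    (hIII1 : B₂₄ * pr = κ₂ * u) (hIII2 : -(B₂₄ * pi) = κ₂ * v)
    (hIV1 : B₂₄ * rr = 0.3465736 * (1 - (mx ^ 2 - my ^ 2))) (hIV2 : -(B₂₄ * ri) = -(0.3465736 * (2 * mx * my)))
    (hV1 : B₂₄ * (pr * rr + pi * ri) + d₂ * sr = κ₂ * u) (hV2 : B₂₄ * (pi * rr - pr * ri) - d₂ * si = κ₂ * v)
    (her : er = pr * sr - pi * si - rr) (hei : ei = pr * si + pi * sr - ri)
    (hG : ∀ CP IP J11 J22 J33 J12 J13 J23 : ℝ, 0.486803 ≤ CP → CP ≤ 0.486813 → 0.48667 ≤ IP → IP ≤ 0.48668 →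
      0.251052 ≤ J11 → J11 ≤ 0.251063 → 0.223131 ≤ J22 → J22 ≤ 0.223142 → 0.251052 ≤ J33 → J33 ≤ 0.251063 →
      0.236666 ≤ J12 → J12 ≤ 0.236678 → 0.250994 ≤ J13 → J13 ≤ 0.251005 → 0.236666 ≤ J23 → J23 ≤ 0.236678 →
      t₂₄ * ((CP + u * IP) / (B₂₄ + κ₂) + (CP - u * IP) / (B₂₄ - κ₂) +
        (J11 / B₂₄ + (J22 - 2 * pr * J12 + (pr ^ 2 + pi ^ 2) * J11) / d₂ +
          (J33 + (sr ^ 2 + si ^ 2) * J22 + (er ^ 2 + ei ^ 2) * J11 - 2 * sr * J23 + 2 * er * J13 -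
            2 * (sr * er + si * ei) * J12) / d₃)) ≤ 1)
    (hB₃4 : 0.6343 ^ 2 * 4 < B₃ ^ 2)
    (h₃0 : t₃ * (0.59228 * (B₃ ^ 2 - 0.63428 ^ 2 * 0) +
        2 * B₃ * (B₃ * 0.5533 - 0.63428 * ((0 : ℝ) / 2) * 0.55286)) ≤ B₃ * (B₃ ^ 2 - 0.6343 ^ 2 * 0))
    (h₃4 : t₃ * (0.59228 * (B₃ ^ 2 - 0.63428 ^ 2 * 4) +
        2 * B₃ * (B₃ * 0.5533 - 0.63428 * ((4 : ℝ) / 2) * 0.55286)) ≤ B₃ * (B₃ ^ 2 - 0.6343 ^ 2 * 4)) :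
    WeilPositivityOnChar χ (4023 / 5000) := by
  set ω₂ : ℂ := ⟨u, v⟩ with hω₂d
  set m : ℂ := ⟨mx, my⟩ with hmd
  set p : ℂ := ⟨pr, pi⟩ with hpd
  set r : ℂ := ⟨rr, ri⟩ with hrd
  set s : ℂ := ⟨sr, si⟩ with hsd
  set c₄ : ℂ := ((0.3465736 : ℝ) : ℂ) * (1 - m * m) with hc₄
  have hω₂ : ‖ω₂‖ = 1 := norm_eq_one_of_sq (by simpa [hω₂d] using hω)
  have hm : (κ₂ : ℂ) * ω₂ = ((0.49013 : ℝ) : ℂ) * (1 - m) := by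
    apply Complex.ext <;> simp [hω₂d, hmd] <;> linarith only [hm1, hm2]
  have nle : ∀ (w : ℂ) (b : ℝ), 0 ≤ b → w.re ^ 2 + w.im ^ 2 ≤ b ^ 2 → ‖w‖ ≤ b := fun w b hb h ↦ by
    rw [Complex.norm_eq_sqrt_sq_add_sq, Real.sqrt_le_iff]; exact ⟨hb, h⟩
  have hMn : ‖m‖ ≤ M := nle _ _ hM0 (by simpa [hmd] using hM)
  have hn₁n : ‖1 - m‖ ≤ n₁ := nle _ _ hn₁0 (by simp [hmd]; linarith only [hn₁])
  have hn₂n : ‖1 - m * m‖ ≤ n₂ := nle _ _ hn₂0 (by simp [hmd]; linarith only [hn₂])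
  have hpn : ‖p‖ ^ 2 = pr ^ 2 + pi ^ 2 := by rw [Complex.sq_norm, Complex.normSq_apply, hpd]; ring
  have hrn : ‖r‖ ^ 2 = rr ^ 2 + ri ^ 2 := by rw [Complex.sq_norm, Complex.normSq_apply, hrd]; ring
  have hsn : ‖s‖ ^ 2 = sr ^ 2 + si ^ 2 := by rw [Complex.sq_norm, Complex.normSq_apply, hsd]; ring
  have he : p * s - r = ⟨er, ei⟩ := by
    apply Complex.ext
    · simp [hpd, hrd, hsd, her]
    · simp [hpd, hrd, hsd, hei]
  have hen : ‖p * s - r‖ ^ 2 = er ^ 2 + ei ^ 2 := by rw [he, Complex.sq_norm, Complex.normSq_apply]; ring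
  have hI' : B₂₄ * ‖p‖ ^ 2 + d₂ = B₂₄ := by rw [hpn]; exact hI
  have hII' : B₂₄ * ‖r‖ ^ 2 + d₂ * ‖s‖ ^ 2 + d₃ = B₂₄ := by rw [hrn, hsn]; exact hII
  have hIII : (B₂₄ : ℂ) * conj p = κ₂ * ω₂ := by
    apply Complex.ext <;> simp [hω₂d, hpd] <;> linarith only [hIII1, hIII2]
  have hIV : (B₂₄ : ℂ) * conj r = c₄ := by
    apply Complex.ext <;> simp [hrd, hmd, hc₄] <;> linarith only [hIV1, hIV2]
  have hV : (B₂₄ : ℂ) * p * conj r + d₂ * conj s = κ₂ * ω₂ := by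
    apply Complex.ext <;> simp [hω₂d, hpd, hrd, hsd] <;> linarith only [hV1, hV2]
  refine weilPositivityOnChar_frontier_of_cell hq1 χ hBq hz hα hβ hyl hyh hω₂ hκ₂ hm hc₄ hδ
    (by simpa [hmd] using c1) (by simpa [hmd] using c2) (by simpa [hmd] using c3) (by simpa [hmd] using c4)
    hMn hn₁n hn₂n hε hκB₂ hBB ht₂₄ ht₃ ht hB₃ hd₂ hd₃ hI' hII' hIII hIV hV ?_ hB₃4 h₃0 h₃4
  intro CP IP J11 J22 J33 J12 J13 J23 a1 a2 a3 a4 a5 a6 a7 a8 a9 a10 a11 a12 a13 a14 a15 a16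
  have hre : (s * conj (p * s - r)).re = sr * er + si * ei := by rw [he]; simp [hsd]
  have hω₂re : ω₂.re = u := by simp [hω₂d]
  have hpre : p.re = pr := by simp [hpd]
  have hsre : s.re = sr := by simp [hsd]
  have here : (p * s - r).re = er := by rw [he]
  rw [hω₂re, hpre, hpn, hsn, hen, hsre, here, hre]
  exact hG CP IP J11 J22 J33 J12 J13 J23 a1 a2 a3 a4 a5 a6 a7 a8 a9 a10 a11 a12 a13 a14 a15 a16

end Summit.Ventures.WeilGRH
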